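import Literature.Combinatorics.Additive.IsoperimetricMethod

/-!
# Hamidoune's critical pair theorem for finite abelian groups (Acta Arith. 96 (2000), §6):
# runs and the periodic part (Lemma 6.1), the `2`-atoms for `κ₂(B) = |B| − 1` (Proposition 6.5),
# Vosper's alternative at composite order (Theorem 6.6)

Topic `Literature/Combinatorics/Additive`.  Cell `mm-stpp` (D-0046), seat `mm-stpp-lit` (gen 15);
continuation of `IsoperimetricMethod.lean` (imported: `conn`, `IsFragment`, `IsAtom`, the
intersection property, Hamidoune 2000 Theorem 6.2 / Corollary 6.3 as
`IsAtom.exists_addSubgroup_of_le`, `IsAtom.exists_addSubgroup_or_card_eq_two`,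
`IsAtom.exists_addSubgroup_of_conn_add_two_le`, and `card_add_pair_zero_eq`,
`exists_addSubgroup_of_add_mem`) and of `Vosper.lean` (`apFinset`, `IsAP`).  Everything here is
PROVED (0 `sorry`, 0 named facts), for FINITE ABELIAN groups in additive notation.

## Source (read at the page this session)

Y. O. Hamidoune, *Some results in additive number theory I: The critical pair theory*, Acta
Arith. 96 (2000) no. 2, 97–119, doi 10.4064/aa96-2-1 [Hamidoune2000] — held as
`paper:doi-10-4064-aa96-2-1` (text, displays intact), §6 read in full (pages p0010–p0013 of the
held text; PDF page = printed page − 96):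

* **Lemma 6.1** (p0010): "Let `B ⊂ G` be such that `|{0, d} + B| = |B| + j`, and let `K` be the
  subgroup generated by `d`.  There is a set `T` (possibly empty) and non-empty arithmetic
  progressions `P₁, …, P_j` with difference `d` such that `B` is a disjoint union of the sets
  `T + K, P₁, …, P_j`." — `eq_filter_union_biUnion_apFinset` (any finite abelian group, any `d`),
  with the one-run-end reading `exists_eq_filter_union_apFinset_of_card_vadd_sdiff_eq_one` and the
  count `IsAtom.exists_eq_pair_of_card_eq_two` (a `2`-atom `∋ 0` of size two is `{0, d}` with
  `|(d + B) ∖ B| + |B| = κ₂(B) + 2`).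
* **Proposition 6.5** (p0012): "Let `B` be a generating subset of a finite abelian group `G` such
  that `0 ∈ B`.  Assume `κ₂(B) = |B| − 1` and let `H` be a `2`-atom containing `0`.  Then one of the
  following conditions holds: (i) `|H| > 2`, and `H` is a subgroup. (ii) `B` is an arithmetic
  progression. (iii) `B` is almost-periodic. (iv) `|B| > |G|/2`, and there is a proper subgroup `K`
  such that `|B| ≥ |G| − |K| + 1`." (p0010: "A subgroup `H` is called a period of `B` if
  `B + H = B` … A subgroup `H` is an almost-period of `B` if there is `b ∈ B` such that `H` is a
  period of `B ∖ b`.  A subset with a non-zero almost-period is called almost-periodic") —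
  `IsAtom.addSubgroup_or_isAP_or_almostPeriodic_or_large`, PROVED as printed (Theorem 6.2 when
  `|H| > 2`; else `H = {0, d}`, `|{0,d} + B| = |B| + 1`, Lemma 6.1 gives `B = (T + K) ⊔ P`; `T = ∅`
  is (ii); `B + K = G` is (iv); otherwise `K` is `2`-admissible and
  `|T + K| + |P| − 1 = κ₂(B) ≤ |B + K| − |K| = |T + K|` forces `|P| = 1`, (iii)).
* **Theorem 6.6** (p0012–0013): "Let `B` be a generating subset of a finite abelian group `G` such
  that `0 ∈ B` and `|B| ≤ |G|/2`.  Then one of the following conditions holds: (i) For all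
  `|A| ≥ 2`, `|A + B| ≥ min(|G| − 1, |A| + |B|)`. (ii) `B` is an arithmetic progression.
  (iii) There is a subgroup `H` such that `|H + B| < min(|G| − 1, |H| + |B| − 1)`." —
  `forall_min_le_card_add_or_isAP_or_exists_addSubgroup`, PROVED as printed (not (i) ⇒ `B` is
  `2`-separable with `κ₂(B) ≤ |B| − 1`; a `2`-atom `H ∋ 0`; Case 1 `κ₂(B) ≤ |B| − 2` or `|H| ≥ 3`:
  `H` is a subgroup by Corollary 6.3, giving (iii) with `K = H`; Case 2: Proposition 6.5, whose
  alternative (iv) contradicts `|B| ≤ |G|/2` and whose almost-period `K = ⟨d⟩` has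
  `|K + B| = |K| + |B| − 1 ≤ |G| − 2`), with (iii) in the NON-STRICT form the printed proof
  establishes (see Deviations).  In `ℤ/pℤ` the only subgroups are `0` and `G`, alternative (iii) is
  void, and the statement is Vosper's alternative for `|B| ≤ p/2` [cite: Vosper1956, Theorem 1].

## Deviations from print

The subgroup `K = ⟨d⟩` is carried as the finset `{0, d, …, (o−1) d} = apFinset 0 d (addOrderOf d)`
(`o` the order of `d`), which is the underlying set of `AddSubgroup.zmultiples d`
(`coe_zmultiples_eq_coe_apFinset`), and Hamidoune's "`T + K`" as the filter
`{x ∈ B : x + K ⊆ B}`; in Lemma 6.1 the pairwise disjointness of the runs `P_i` is not recorded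
(only `B = (T + K) ∪ ⋃ P_i`, each `P_i` disjoint from `T + K`, of exact length, leaving `B` at its
end, and `j = |(d + B) ∖ B|`).  In Proposition 6.5 "almost-periodic" is rendered concretely as
"`d + (B ∖ {b}) = B ∖ {b}` for some `b ∈ B` and `d ≠ 0`, with `B ∖ {b} ≠ ∅`" (so the subgroup
`⟨d⟩ ≠ 0` is a period of `B ∖ {b}`), (ii) as `IsAP B d` for some `d ≠ 0`, (iv)'s proper subgroup
is produced together with its underlying finset `Kf` (`|Kf| < |G|`, `|G| + 1 ≤ |B| + |Kf|`), and
the printed hypothesis "`B` generating" is dropped — the printed proof does not use it.  In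
Theorem 6.6 "`B` generating" is likewise dropped, `|B| ≤ |G|/2` is written `2|B| ≤ |G|`, and
alternative (iii), printed "`|H + B| < min(|G| − 1, |H| + |B| − 1)`", is stated as: some subgroup
`K` (with its finset `Kf`, `|Kf| ≥ 2`) has `|K + B| ≤ |G| − 2` and `|K + B| ≤ |K| + |B| − 1` —
exactly what the printed proof yields ("|H + B| < |G| and |B| − 1 ≥ κ₂(B) = |H + B| − |H|.  This
proves (iii)"; in Case 2 "|K + B| = |K| + |B| − 1"); the strict printed form is not what is proved
there (Case 1 with `κ₂(B) = |B| − 1` gives equality `|H + B| = |H| + |B| − 1`).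
Census-silent Literature shelf: no row, bracket, threshold or verdict word of the cell moves; no `ω`.
-/

namespace Literature.Combinatorics.Additive

open Finset
open scoped Pointwise

namespace Isoperimetric

variable {G : Type*} [AddCommGroup G] [Fintype G] [DecidableEq G]
variable {B : Finset G}

omit [Fintype G] in
/-- A `d`-invariant set (`d + P = P`) contains `x` iff it contains `x + d`. [cite: Hamidoune2000,
§6 (periods: "A subgroup H is called a period of B if B + H = B")] -/
theorem mem_iff_add_mem_of_vadd_eq {P : Finset G} {d : G} (h : d +ᵥ P = P) (x : G) :
    x ∈ P ↔ x + d ∈ P := by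
  rw [← vadd_mem_vadd_finset_iff d, h, vadd_eq_add, add_comm]

omit [Fintype G] in
/-- A `d`-invariant set contains `x` iff it contains `x + n • d`. [cite: Hamidoune2000, §6] -/
theorem mem_iff_add_nsmul_mem_of_vadd_eq {P : Finset G} {d : G} (h : d +ᵥ P = P) (x : G)
    (n : ℕ) : x ∈ P ↔ x + n • d ∈ P := by
  induction n with
  | zero => rw [zero_nsmul, add_zero]
  | succ n ih => rw [ih, mem_iff_add_mem_of_vadd_eq h, succ_nsmul, add_assoc]

/-- Every multiple `n • d` lies in `{0, d, …, (o−1) d}`, `o` the order of `d` (this finset is the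
subgroup generated by `d`). [cite: Hamidoune2000, §6 ("let K be the subgroup generated by d")] -/
theorem nsmul_mem_apFinset_zero_addOrderOf (d : G) (n : ℕ) :
    n • d ∈ apFinset (0 : G) d (addOrderOf d) := by
  rw [mem_apFinset]
  exact ⟨n % addOrderOf d, Nat.mod_lt _ (addOrderOf_pos d), by rw [zero_add, mod_addOrderOf_nsmul]⟩

/-- `{0, d, …, (o−1) d}` is closed under addition. [cite: Hamidoune2000, §6] -/
theorem add_mem_apFinset_zero_addOrderOf {d x y : G} (hx : x ∈ apFinset (0 : G) d (addOrderOf d))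
    (hy : y ∈ apFinset (0 : G) d (addOrderOf d)) : x + y ∈ apFinset (0 : G) d (addOrderOf d) := by
  rw [mem_apFinset] at hx hy
  obtain ⟨i, -, rfl⟩ := hx
  obtain ⟨j, -, rfl⟩ := hy
  rw [zero_add, zero_add, ← add_nsmul]
  exact nsmul_mem_apFinset_zero_addOrderOf d (i + j)

/-- For `d ≠ 0` the subgroup `{0, d, …}` generated by `d` has at least two elements.
[cite: Hamidoune2000, §6 (proof of Proposition 6.5: "Since d ≠ 0, we have |K| ≥ 2")] -/
theorem two_le_card_apFinset_zero_addOrderOf {d : G} (hd : d ≠ 0) :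
    2 ≤ #(apFinset (0 : G) d (addOrderOf d)) := by
  have h0 : (0 : G) ∈ apFinset (0 : G) d (addOrderOf d) := by
    simpa using nsmul_mem_apFinset_zero_addOrderOf d 0
  have h1 : d ∈ apFinset (0 : G) d (addOrderOf d) := by
    simpa using nsmul_mem_apFinset_zero_addOrderOf d 1
  calc 2 = #({0, d} : Finset G) := (card_pair hd.symm).symm
    _ ≤ _ := card_le_card (insert_subset h0 (singleton_subset_iff.2 h1))

/-- There is a subgroup `K = ⟨d⟩` whose underlying set is `{0, d, …, (o−1) d}`.
[cite: Hamidoune2000, §6 ("let K be the subgroup generated by d")] -/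
theorem exists_addSubgroup_coe_eq_apFinset_zero_addOrderOf (d : G) :
    ∃ K : AddSubgroup G, (K : Set G) = apFinset (0 : G) d (addOrderOf d) :=
  exists_addSubgroup_of_add_mem (by simpa using nsmul_mem_apFinset_zero_addOrderOf d 0)
    fun _ hx _ hy => add_mem_apFinset_zero_addOrderOf hx hy

omit [Fintype G] in
/-- A nonempty `d`-invariant set is at least as large as `⟨d⟩` (it contains a coset).
[cite: Hamidoune2000, §6 (T + K is a union of K-cosets)] -/
theorem card_apFinset_zero_addOrderOf_le_card {P : Finset G} {d : G} (h : d +ᵥ P = P)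
    (hP : P.Nonempty) : #(apFinset (0 : G) d (addOrderOf d)) ≤ #P := by
  obtain ⟨x, hx⟩ := hP
  calc #(apFinset (0 : G) d (addOrderOf d)) = #(x +ᵥ apFinset (0 : G) d (addOrderOf d)) :=
        (card_vadd_finset _ _).symm
    _ ≤ #P := by
        refine card_le_card fun y hy => ?_
        obtain ⟨z, hz, rfl⟩ := mem_vadd_finset.1 hy
        rw [mem_apFinset] at hz
        obtain ⟨i, -, rfl⟩ := hz
        rw [vadd_eq_add, zero_add]
        exact (mem_iff_add_nsmul_mem_of_vadd_eq h x i).1 hx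

/-- **`K + B` for `B = P ⊔ (progression)`:** if `P` is `d`-invariant, `s ∉ P` and `ℓ ≥ 1`, then
`K + (P ∪ {s, s+d, …, s+(ℓ−1)d}) = P ⊔ (s + K)` (disjointly), `K = ⟨d⟩`.
[cite: Hamidoune2000, §6 (proof of Proposition 6.5: B + K = (T + K) ∪ (P + K))] -/
theorem apFinset_zero_addOrderOf_add_union_apFinset {P : Finset G} {d s : G} (h : d +ᵥ P = P)
    (hs : s ∉ P) {ℓ : ℕ} (hℓ : 1 ≤ ℓ) :
    apFinset (0 : G) d (addOrderOf d) + (P ∪ apFinset s d ℓ) =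
        P ∪ (s +ᵥ apFinset (0 : G) d (addOrderOf d)) ∧
      Disjoint P (s +ᵥ apFinset (0 : G) d (addOrderOf d)) := by
  set Kf := apFinset (0 : G) d (addOrderOf d) with hKf
  have hK0 : (0 : G) ∈ Kf := by simpa using nsmul_mem_apFinset_zero_addOrderOf d 0
  refine ⟨Subset.antisymm ?_ ?_, ?_⟩
  · intro x hx
    obtain ⟨c, hc, b, hb, rfl⟩ := mem_add.1 hx
    rw [mem_union] at hb ⊢
    have hc' := hc
    rw [hKf, mem_apFinset] at hc'
    obtain ⟨i, -, hic⟩ := hc'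
    rcases hb with hb | hb
    · left
      rw [← hic, zero_add, add_comm]
      exact (mem_iff_add_nsmul_mem_of_vadd_eq h b i).1 hb
    · right
      rw [mem_apFinset] at hb
      obtain ⟨j, -, rfl⟩ := hb
      refine mem_vadd_finset.2 ⟨c + j • d, add_mem_apFinset_zero_addOrderOf hc
        (nsmul_mem_apFinset_zero_addOrderOf d j), ?_⟩
      rw [vadd_eq_add]; abel
  · intro x hx
    rw [mem_union] at hx
    rcases hx with hx | hx
    · exact mem_add.2 ⟨0, hK0, x, mem_union_left _ hx, zero_add x⟩
    · obtain ⟨c, hc, rfl⟩ := mem_vadd_finset.1 hx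
      refine mem_add.2 ⟨c, hc, s, mem_union_right _ (mem_apFinset.2 ⟨0, hℓ, by
        rw [zero_nsmul, add_zero]⟩), ?_⟩
      rw [vadd_eq_add, add_comm]
  · rw [disjoint_left]
    intro x hxP hxs
    obtain ⟨c, hc, rfl⟩ := mem_vadd_finset.1 hxs
    rw [hKf, mem_apFinset] at hc
    obtain ⟨i, -, rfl⟩ := hc
    rw [vadd_eq_add, zero_add] at hxP
    exact hs ((mem_iff_add_nsmul_mem_of_vadd_eq h s i).2 hxP)

/-- `x + ⟨d⟩ ⊆ B` iff the whole forward `d`-walk from `x` stays in `B`. [cite: Hamidoune2000, §6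
(T + K ⊆ B: the K-cosets contained in B)] -/
theorem vadd_apFinset_zero_addOrderOf_subset_iff {B : Finset G} {d x : G} :
    x +ᵥ apFinset (0 : G) d (addOrderOf d) ⊆ B ↔ ∀ j : ℕ, x + j • d ∈ B := by
  constructor
  · intro h j
    exact h (mem_vadd_finset.2 ⟨j • d, nsmul_mem_apFinset_zero_addOrderOf d j, rfl⟩)
  · intro h y hy
    obtain ⟨z, hz, rfl⟩ := mem_vadd_finset.1 hy
    rw [mem_apFinset] at hz
    obtain ⟨i, -, rfl⟩ := hz
    rw [vadd_eq_add, zero_add]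
    exact h i

/-- **Hamidoune 2000, Lemma 6.1 (runs and the periodic part), in any finite abelian group.**
For `B ⊆ G` and `d ∈ G` let `K = ⟨d⟩ = {0, d, 2d, …}` and `P = {x ∈ B : x + K ⊆ B}` (the union of
the `K`-cosets contained in `B`, i.e. `T + K` in Hamidoune's notation), and call `s ∈ B` with
`s − d ∉ B` a run-start.  Then `P` is `d`-invariant, `B` is the union of `P` and of the maximal
`d`-progressions `{s, s + d, …, s + (ℓ_s − 1) d} ⊆ B` issued from the run-starts, each of which is
nonempty, has exactly `ℓ_s` elements, ends outside `B` (`s + ℓ_s d ∉ B`) and is disjoint from `P`;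
and the number of run-starts is `|(d + B) ∖ B| = |{0, d} + B| − |B|` (cf. `card_add_pair_zero_eq`).
This is the printed "`B` is a disjoint union of `T + K, P₁, …, P_j`, `j = |{0,d} + B| − |B|`"
(pairwise disjointness of the runs is not recorded here).  For `G = ℤ/pℤ` and `B ≠ G` the
periodic part is empty, cf. `eq_biUnion_apFinset_runs`. [cite: Hamidoune2000, §6, Lemma 6.1] -/
theorem eq_filter_union_biUnion_apFinset (B : Finset G) (d : G) :
    ∃ ℓ : G → ℕ,
      B = (B.filter fun x => x +ᵥ apFinset (0 : G) d (addOrderOf d) ⊆ B) ∪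
            (B.filter fun s => s - d ∉ B).biUnion (fun s => apFinset s d (ℓ s)) ∧
      d +ᵥ (B.filter fun x => x +ᵥ apFinset (0 : G) d (addOrderOf d) ⊆ B) =
        (B.filter fun x => x +ᵥ apFinset (0 : G) d (addOrderOf d) ⊆ B) ∧
      #(B.filter fun s => s - d ∉ B) = #((d +ᵥ B) \ B) ∧
      (∀ s : G, apFinset s d (ℓ s) ⊆ B) ∧
      (∀ s ∈ B, s - d ∉ B → 1 ≤ ℓ s ∧ #(apFinset s d (ℓ s)) = ℓ s ∧ s + ℓ s • d ∉ B ∧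
        ∀ x ∈ apFinset s d (ℓ s), ¬ (x +ᵥ apFinset (0 : G) d (addOrderOf d) ⊆ B)) := by
  classical
  set P := B.filter fun x => x +ᵥ apFinset (0 : G) d (addOrderOf d) ⊆ B with hP
  have hPiff : ∀ x, x ∈ P ↔ x ∈ B ∧ ∀ j : ℕ, x + j • d ∈ B := fun x => by
    rw [hP, mem_filter, vadd_apFinset_zero_addOrderOf_subset_iff]
  set o := addOrderOf d with ho
  have ho0 : o • d = 0 := addOrderOf_nsmul_eq_zero d
  have ho1 : 1 ≤ o := addOrderOf_pos d
  have hod : (o - 1) • d = -d := by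
    have : (o - 1) • d + d = 0 := by rw [← succ_nsmul, Nat.sub_add_cancel ho1, ho0]
    exact eq_neg_of_add_eq_zero_left this
  -- run length: the first exit time if the forward walk leaves `B`, else `0`
  let ℓ : G → ℕ := fun s => if h : ∃ j : ℕ, s + j • d ∉ B then Nat.find h else 0
  have hℓ_of : ∀ s, ∀ h : ∃ j : ℕ, s + j • d ∉ B, ℓ s = Nat.find h := fun s h => by
    simp only [ℓ, dif_pos h]
  have hℓ_spec : ∀ s, (∃ j : ℕ, s + j • d ∉ B) → s + ℓ s • d ∉ B := fun s h => by
    rw [hℓ_of s h]; exact Nat.find_spec h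
  have hℓ_min : ∀ s, ∀ j < ℓ s, s + j • d ∈ B := fun s j hj => by
    by_cases h : ∃ j : ℕ, s + j • d ∉ B
    · rw [hℓ_of s h] at hj
      have := Nat.find_min h hj
      push Not at this
      exact this
    · simp only [ℓ, dif_neg h] at hj
      omega
  -- the periodic part is `d`-invariant
  have hPd : d +ᵥ P = P := by
    apply Subset.antisymm
    · intro x hx
      obtain ⟨y, hy, rfl⟩ := mem_vadd_finset.1 hx
      rw [hPiff] at hy
      rw [hPiff]
      refine ⟨by have := hy.2 1; rwa [one_nsmul, add_comm] at this, fun j => ?_⟩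
      have := hy.2 (j + 1)
      rwa [vadd_eq_add, show d + y + j • d = y + (j + 1) • d by rw [succ_nsmul]; abel]
    · intro x hx
      rw [hPiff] at hx
      refine mem_vadd_finset.2 ⟨x - d, ?_, by rw [vadd_eq_add]; abel⟩
      rw [hPiff]
      have key : ∀ j : ℕ, x - d + j • d ∈ B := by
        intro j
        have := hx.2 (j + (o - 1))
        have e : x + (j + (o - 1)) • d = x - d + j • d := by rw [add_nsmul, hod]; abel
        rwa [e] at this
      exact ⟨by simpa using key 0, key⟩
  -- a run-start has a genuine (positive, `< o`) run length
  have hstart : ∀ s ∈ B, s - d ∉ B →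
      (∃ j : ℕ, s + j • d ∉ B) ∧ 1 ≤ ℓ s ∧ ℓ s ≤ o - 1 := by
    intro s hs hsd
    have hex : ∃ j : ℕ, s + j • d ∉ B := ⟨o - 1, by rw [hod, ← sub_eq_add_neg]; exact hsd⟩
    refine ⟨hex, ?_, ?_⟩
    · by_contra h0
      have h0' : ℓ s = 0 := by omega
      have := hℓ_spec s hex
      rw [h0', zero_nsmul, add_zero] at this
      exact this hs
    · rw [hℓ_of s hex]
      exact Nat.find_min' hex (by rw [hod, ← sub_eq_add_neg]; exact hsd)
  refine ⟨ℓ, ?_, hPd, ?_, fun s x hx => ?_, fun s hs hsd => ?_⟩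
  · -- `B = P ∪ ⋃ runs`
    ext b
    rw [mem_union, hPiff, mem_biUnion]
    constructor
    · intro hb
      by_cases hbP : ∀ j : ℕ, b + j • d ∈ B
      · exact Or.inl ⟨hb, hbP⟩
      · right
        push Not at hbP
        obtain ⟨j, hj⟩ := hbP
        -- walk backwards from `b` to the start of its run: some `b - (i+1) d ∉ B`
        have hreach : b - (o * (j + 1) - j - 1 + 1) • d = b + j • d := by
          have hle : j + 1 ≤ o * (j + 1) := by nlinarith
          have h1 : o * (j + 1) - j - 1 + 1 + j = o * (j + 1) := by omega
          have h2 : (o * (j + 1) - j - 1 + 1) • d + j • d = 0 := by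
            rw [← add_nsmul, h1]
            exact addOrderOf_dvd_iff_nsmul_eq_zero.1 (dvd_mul_right o (j + 1))
          rw [sub_eq_iff_eq_add, add_assoc, add_comm (j • d), h2, add_zero]
        have hback : ∃ i : ℕ, b - (i + 1) • d ∉ B := ⟨_, by rw [hreach]; exact hj⟩
        let i := Nat.find hback
        have hi_spec : b - (i + 1) • d ∉ B := Nat.find_spec hback
        have hi_min : ∀ i' < i, b - (i' + 1) • d ∈ B := fun i' hi' => by
          have := Nat.find_min hback hi'
          push Not at this
          exact this
        have hrun : ∀ i' ≤ i, b - i' • d ∈ B := by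
          intro i' hi'
          rcases Nat.eq_zero_or_pos i' with h0 | hpos
          · rw [h0, zero_nsmul, sub_zero]; exact hb
          · have := hi_min (i' - 1) (by omega)
            rwa [Nat.sub_add_cancel hpos] at this
        have hs' : b - i • d - d ∉ B := by rwa [sub_sub, ← succ_nsmul]
        refine ⟨b - i • d, mem_filter.2 ⟨hrun i le_rfl, hs'⟩, mem_apFinset.2 ⟨i, ?_, by
          rw [sub_add_cancel]⟩⟩
        -- `i < ℓ (b - i d)`: the start `b - i d` has an exit, and it is not before `b`
        obtain ⟨hex, -, -⟩ := hstart (b - i • d) (hrun i le_rfl) hs'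
        by_contra hlt
        push Not at hlt
        apply hℓ_spec (b - i • d) hex
        have : b - i • d + ℓ (b - i • d) • d = b - (i - ℓ (b - i • d)) • d := by
          obtain ⟨r, hr⟩ : ∃ r, i = ℓ (b - i • d) + r := ⟨i - ℓ (b - i • d), by omega⟩
          generalize ℓ (b - i • d) = l at hr ⊢
          rw [hr, Nat.add_sub_cancel_left, add_nsmul]
          abel
        rw [this]
        exact hrun _ (Nat.sub_le _ _)
    · rintro (⟨hb, -⟩ | ⟨s, -, hbs⟩)
      · exact hb
      · rw [mem_apFinset] at hbs
        obtain ⟨i, hi, rfl⟩ := hbs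
        exact hℓ_min s i hi
  · -- run-starts and run-ends are equinumerous
    have h1 : B.filter (fun s => s - d ∉ B) = B \ (d +ᵥ B) := by
      ext s
      simp only [mem_filter, mem_sdiff, mem_vadd_finset, vadd_eq_add]
      constructor
      · rintro ⟨hs, hsd⟩
        refine ⟨hs, ?_⟩
        rintro ⟨y, hy, rfl⟩
        apply hsd
        rwa [add_sub_cancel_left]
      · rintro ⟨hs, hno⟩
        exact ⟨hs, fun hsd => hno ⟨s - d, hsd, by abel⟩⟩
    rw [h1, card_sdiff_comm]
    rw [card_vadd_finset]
  · -- runs stay inside `B`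
    rw [mem_apFinset] at hx
    obtain ⟨j, hj, rfl⟩ := hx
    exact hℓ_min s j hj
  · -- a run from a run-start: positive length, exact cardinality, exits, misses `P`
    obtain ⟨hex, h1, hlo⟩ := hstart s hs hsd
    refine ⟨h1, ?_, hℓ_spec s hex, fun x hx hall => ?_⟩
    · -- `i ↦ s + i d` is injective on `i < ℓ s`
      rw [apFinset, card_image_of_injOn, card_range]
      -- a shorter period would put `s - d` in `B`
      have key : ∀ i j : ℕ, j < ℓ s → s + i • d = s + j • d → ¬ i < j := by
        intro i j hj hij hlt
        have hper : (j - i) • d = 0 := by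
          have hsum : s + i • d + (j - i) • d = s + i • d := by
            rw [add_assoc, ← add_nsmul, Nat.add_sub_cancel' hlt.le, ← hij]
          simpa using hsum
        have hmem := hℓ_min s (j - i - 1) (by omega)
        have e : s + (j - i - 1) • d = s - d := by
          have h3 : (j - i - 1) • d + d = 0 := by
            rw [← succ_nsmul, show j - i - 1 + 1 = j - i by omega, hper]
          rw [sub_eq_add_neg, ← eq_neg_of_add_eq_zero_left h3]
        rw [e] at hmem
        exact hsd hmem
      intro i hi j hj hij
      simp only [coe_range, Set.mem_Iio] at hi hj
      simp only at hij
      rcases lt_trichotomy i j with hlt | heq | hgt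
      · exact absurd hlt (key i j hj hij)
      · exact heq
      · exact absurd hgt (key j i hi hij.symm)
    · rw [vadd_apFinset_zero_addOrderOf_subset_iff] at hall
      rw [mem_apFinset] at hx
      obtain ⟨i, hi, rfl⟩ := hx
      have := hall (ℓ s - i)
      rw [add_assoc, ← add_nsmul, Nat.add_sub_cancel' hi.le] at this
      exact hℓ_spec s hex this

/-- **A `2`-atom of size two through `0` is `{0, d}` and counts the run-ends:**
`|(d + B) ∖ B| + |B| = κ₂(B) + 2` (from `|{0,d} + B| − 2 = κ₂(B)` and `card_add_pair_zero_eq`).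
[cite: Hamidoune2000, §6 (proof of Proposition 6.5: "put H = {0, d} … |{0, d} + B| = 1 + |B|")] -/
theorem IsAtom.exists_eq_pair_of_card_eq_two (h0 : (0 : G) ∈ B) {H : Finset G}
    (hH : IsAtom 2 B H) (h0H : (0 : G) ∈ H) (hH2 : #H = 2) :
    ∃ d : G, d ≠ 0 ∧ H = {0, d} ∧ #((d +ᵥ B) \ B) + #B = conn 2 B + 2 := by
  classical
  obtain ⟨a, a', haa', hHeq⟩ := card_eq_two.1 hH2
  have hd : ∃ d : G, d ≠ 0 ∧ H = {0, d} := by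
    rw [hHeq, mem_insert, mem_singleton] at h0H
    rcases h0H with rfl | rfl
    · exact ⟨a', haa'.symm, hHeq⟩
    · exact ⟨a, haa', by rw [hHeq, pair_comm]⟩
  obtain ⟨d, hd0, rfl⟩ := hd
  refine ⟨d, hd0, rfl, ?_⟩
  have hfrag := hH.1.2
  have hge : #({0, d} : Finset G) ≤ #(({0, d} : Finset G) + B) := card_le_card_add h0 _
  have hpair : #({0, d} : Finset G) = 2 := card_pair hd0.symm
  have hcount := card_add_pair_zero_eq B d
  rw [add_comm B] at hcount
  omega

/-- **From one run-end to the shape `B = (T + K) ⊔ P`:** if `|(d + B) ∖ B| = 1`, then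
`B = P ⊔ {s, s + d, …, s + (ℓ−1) d}` with `P = {x ∈ B : x + ⟨d⟩ ⊆ B}` `d`-invariant, `s ∈ B`,
`ℓ ≥ 1`, the progression having exactly `ℓ` elements, none in `P`. [cite: Hamidoune2000, §6,
Lemma 6.1 (case j = 1, as used in the proof of Proposition 6.5)] -/
theorem exists_eq_filter_union_apFinset_of_card_vadd_sdiff_eq_one {B : Finset G} {d : G}
    (h1 : #((d +ᵥ B) \ B) = 1) :
    ∃ s ∈ B, ∃ ℓ : ℕ, 1 ≤ ℓ ∧
      B = (B.filter fun x => x +ᵥ apFinset (0 : G) d (addOrderOf d) ⊆ B) ∪ apFinset s d ℓ ∧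
      d +ᵥ (B.filter fun x => x +ᵥ apFinset (0 : G) d (addOrderOf d) ⊆ B) =
        (B.filter fun x => x +ᵥ apFinset (0 : G) d (addOrderOf d) ⊆ B) ∧
      #(apFinset s d ℓ) = ℓ ∧
      ∀ x ∈ apFinset s d ℓ, x ∉ B.filter fun x => x +ᵥ apFinset (0 : G) d (addOrderOf d) ⊆ B := by
  classical
  obtain ⟨ℓ, hB, hPd, hcard, -, hruns⟩ := eq_filter_union_biUnion_apFinset B d
  rw [h1] at hcard
  obtain ⟨s, hs⟩ := card_eq_one.1 hcard
  have hsB : s ∈ B ∧ s - d ∉ B := by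
    have : s ∈ B.filter fun s => s - d ∉ B := by rw [hs]; exact mem_singleton_self s
    exact mem_filter.1 this
  obtain ⟨hℓ1, hℓcard, -, hdisj⟩ := hruns s hsB.1 hsB.2
  refine ⟨s, hsB.1, ℓ s, hℓ1, ?_, hPd, hℓcard, fun x hx hxP => hdisj x hx (mem_filter.1 hxP).2⟩
  rw [hs, singleton_biUnion] at hB
  exact hB

/-- **Hamidoune 2000, Proposition 6.5 (the `2`-atoms for `κ₂(B) = |B| − 1`), any finite abelian
group.**  Let `0 ∈ B ⊆ G` with `κ₂(B) = |B| − 1` and let `H ∋ 0` be a `2`-atom of `B`.  Then one of: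
(i) `|H| > 2` and `H` is a subgroup; (ii) `B` is an arithmetic progression (with a non-zero
difference); (iii) `B` is almost-periodic: for some `b ∈ B` the set `B ∖ {b} ≠ ∅` is invariant under
a non-zero `d` (so the subgroup `⟨d⟩ ≠ 0` is a period of `B ∖ {b}`); (iv) `|B| > |G|/2` and there
is a proper subgroup `K` (here `K = ⟨d⟩`, given with its underlying finset) with
`|B| ≥ |G| − |K| + 1`.  The printed hypothesis "`B` generating" is not needed for the printed
proof and is dropped.  Proof as printed: Theorem 6.2 (`IsAtom.exists_addSubgroup_of_le`) when
`|H| > 2`; otherwise `H = {0, d}`, `|{0,d} + B| = |B| + 1`, Lemma 6.1 gives `B = (T + K) ⊔ P`, and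
either `T = ∅` (ii), or `B + K = G` (iv), or `K` is `2`-admissible and
`|T + K| + |P| − 1 = κ₂(B) ≤ |B + K| − |K| = |T + K|` forces `|P| = 1` (iii).
[cite: Hamidoune2000, §6, Proposition 6.5] -/
theorem IsAtom.addSubgroup_or_isAP_or_almostPeriodic_or_large (h0 : (0 : G) ∈ B)
    (hκ : conn 2 B + 1 = #B) {H : Finset G} (hH : IsAtom 2 B H) (h0H : (0 : G) ∈ H) :
    (2 < #H ∧ ∃ K : AddSubgroup G, (K : Set G) = H) ∨
    (∃ d : G, d ≠ 0 ∧ IsAP B d) ∨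
    (∃ d : G, d ≠ 0 ∧ ∃ b ∈ B, (B.erase b).Nonempty ∧ d +ᵥ B.erase b = B.erase b) ∨
    (Fintype.card G < 2 * #B ∧ ∃ K : AddSubgroup G, ∃ Kf : Finset G, (K : Set G) = Kf ∧
        #Kf < Fintype.card G ∧ Fintype.card G + 1 ≤ #B + #Kf) := by
  classical
  have hHa := hH.1.1
  unfold IsAdm at hHa
  by_cases hH2 : 2 < #H
  · exact Or.inl ⟨hH2, hH.exists_addSubgroup_of_le h0 h0H (by omega)⟩
  right
  have hH2' : #H = 2 := by omega
  obtain ⟨d, hd, rfl, hcount⟩ := hH.exists_eq_pair_of_card_eq_two h0 h0H hH2'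
  have h1 : #((d +ᵥ B) \ B) = 1 := by omega
  obtain ⟨s, hsB, ℓ, hℓ1, hBeq, hPd, hPcard, hPdisj⟩ :=
    exists_eq_filter_union_apFinset_of_card_vadd_sdiff_eq_one h1
  set P := B.filter fun x => x +ᵥ apFinset (0 : G) d (addOrderOf d) ⊆ B with hP
  have hsP : s ∉ P := hPdisj s (mem_apFinset.2 ⟨0, hℓ1, by rw [zero_nsmul, add_zero]⟩)
  have hdisjP : Disjoint P (apFinset s d ℓ) := disjoint_right.2 fun x hx => hPdisj x hx
  have hBcard : #B = #P + ℓ := by rw [hBeq, card_union_of_disjoint hdisjP, hPcard]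
  rcases P.eq_empty_or_nonempty with hP0 | hPne
  · -- (ii) `B` is a progression
    left
    refine ⟨d, hd, s, ?_⟩
    rw [hBcard, hP0, card_empty, zero_add]
    rw [hP0, empty_union] at hBeq
    exact hBeq
  right
  set Kf := apFinset (0 : G) d (addOrderOf d) with hKf
  obtain ⟨hKB, hdisjK⟩ := apFinset_zero_addOrderOf_add_union_apFinset hPd hsP hℓ1
  rw [← hBeq] at hKB
  have hKBcard : #(Kf + B) = #P + #Kf := by
    rw [hKB, card_union_of_disjoint hdisjK, card_vadd_finset]
  have hKle : #Kf ≤ #P := card_apFinset_zero_addOrderOf_le_card hPd hPne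
  have hK2 : 2 ≤ #Kf := two_le_card_apFinset_zero_addOrderOf hd
  obtain ⟨K, hK⟩ := exists_addSubgroup_coe_eq_apFinset_zero_addOrderOf d
  by_cases hfull : P ∪ (s +ᵥ Kf) = univ
  · -- (iv) `B + K = G`
    right
    have hn : Fintype.card G = #P + #Kf := by
      rw [← card_univ, ← hfull, card_union_of_disjoint hdisjK, card_vadd_finset]
    refine ⟨by omega, K, Kf, hK, by have := hPne.card_pos; omega, by omega⟩
  · -- (iii) `K` is `2`-admissible, so `|P| = 1`
    left
    obtain ⟨x, hx⟩ : ∃ x, x ∉ P ∪ (s +ᵥ Kf) := by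
      by_contra h
      push Not at h
      exact hfull (eq_univ_of_forall h)
    have hx' : x - d ∉ P ∪ (s +ᵥ Kf) := by
      rw [mem_union, not_or] at hx ⊢
      refine ⟨fun h => hx.1 ?_, fun h => hx.2 ?_⟩
      · have := (mem_iff_add_mem_of_vadd_eq hPd (x - d)).1 h
        rwa [sub_add_cancel] at this
      · obtain ⟨c, hc, hcx⟩ := mem_vadd_finset.1 h
        refine mem_vadd_finset.2 ⟨c + d, add_mem_apFinset_zero_addOrderOf hc
          (by simpa using nsmul_mem_apFinset_zero_addOrderOf d 1), ?_⟩
        rw [vadd_eq_add] at hcx ⊢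
        rw [← add_assoc, hcx, sub_add_cancel]
    have hout : ({x, x - d} : Finset G) ⊆ univ \ (Kf + B) := by
      rw [hKB]
      intro y hy
      rw [mem_insert, mem_singleton] at hy
      rw [mem_sdiff]
      rcases hy with rfl | rfl
      · exact ⟨mem_univ _, hx⟩
      · exact ⟨mem_univ _, hx'⟩
    have hxx : x ≠ x - d := by
      intro h; apply hd; have := sub_eq_self.1 h.symm; exact this
    have h2out : #(Kf + B) + 2 ≤ Fintype.card G := by
      have := card_le_card hout
      rw [card_pair hxx, card_univ_sdiff] at this
      have := card_le_univ (Kf + B)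
      omega
    have hadm : IsAdm 2 B Kf := ⟨hK2, h2out⟩
    have hκK := conn_le hadm
    have hℓ : ℓ = 1 := by omega
    rw [hℓ, apFinset_one] at hBeq
    refine ⟨d, hd, s, hsB, ?_⟩
    have herase : B.erase s = P := by
      ext x
      rw [mem_erase]
      constructor
      · rintro ⟨hxs, hxB⟩
        rw [hBeq, mem_union, mem_singleton] at hxB
        exact hxB.resolve_right hxs
      · intro hxP
        refine ⟨fun h => hsP (h ▸ hxP), ?_⟩
        rw [hBeq]
        exact mem_union_left _ hxP
    rw [herase]
    exact ⟨hPne, hPd⟩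

/-- **Hamidoune 2000, Theorem 6.6 — the critical pair theorem for finite abelian groups (Vosper's
alternative at composite order).**  Let `0 ∈ B ⊆ G` with `|B| ≤ |G|/2`.  Then one of: (i) every
`A` with `|A| ≥ 2` has `|A + B| ≥ min(|G| − 1, |A| + |B|)`; (ii) `B` is an arithmetic progression
(non-zero difference); (iii) some subgroup `K` (given with its underlying finset, `|K| ≥ 2`) has
`|K + B| ≤ |G| − 2` and `|K + B| ≤ |K| + |B| − 1` — so `K` itself witnesses the failure of (i).
About (iii): the printed text reads "`|H + B| < min(|G| − 1, |H| + |B| − 1)`", but the printed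
proof ("|H + B| < |G| and |B| − 1 ≥ κ₂(B) = |H + B| − |H|. This proves (iii)"; in Case 2
"|K + B| = |K| + |B| − 1") establishes exactly the non-strict form recorded here, which is what
we state.  The printed hypothesis "`B` generating" is not used by the printed proof and is
dropped.  Proof as printed: not (i) makes `B` `2`-separable with `κ₂(B) ≤ |B| − 1`; take a
`2`-atom `H ∋ 0`; if `κ₂(B) ≤ |B| − 2` or `|H| ≥ 3`, `H` is a subgroup (Corollary 6.3) and (iii)
holds with `K = H`; otherwise Proposition 6.5 gives (ii), or an almost-period `K = ⟨d⟩` of `B`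
with `|K + B| = |K| + |B| − 1 ≤ |G| − 2` (iii) (its alternative (iv) contradicts `|B| ≤ |G|/2`).
For `G = ℤ/pℤ` the only subgroups are `0` and `G`, and (iii) is impossible, recovering Vosper's
alternative "(i) or (ii)" in the range `|B| ≤ p/2`. [cite: Hamidoune2000, §6, Theorem 6.6]
[cite: Vosper1956, Theorem 1 (the prime case)] -/
theorem forall_min_le_card_add_or_isAP_or_exists_addSubgroup (h0 : (0 : G) ∈ B)
    (hBn : 2 * #B ≤ Fintype.card G) :
    (∀ A : Finset G, 2 ≤ #A → min (Fintype.card G - 1) (#A + #B) ≤ #(A + B)) ∨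
    (∃ d : G, d ≠ 0 ∧ IsAP B d) ∨
    (∃ K : AddSubgroup G, ∃ Kf : Finset G, (K : Set G) = Kf ∧ 2 ≤ #Kf ∧
        #(Kf + B) + 2 ≤ Fintype.card G ∧ #(Kf + B) + 1 ≤ #Kf + #B) := by
  classical
  rw [or_iff_not_imp_left]
  intro hnot
  push Not at hnot
  obtain ⟨A, hA2, hAlt⟩ := hnot
  rw [lt_min_iff] at hAlt
  have hAn : #(A + B) + 1 < Fintype.card G := Nat.lt_sub_iff_add_lt.1 hAlt.1
  have hadmA : IsAdm 2 B A := ⟨hA2, by omega⟩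
  have hκ : conn 2 B + 1 ≤ #B := by
    have := conn_le hadmA
    have := card_le_card_add h0 A
    omega
  obtain ⟨A₀, hA₀⟩ := exists_isAtom ⟨A, hadmA⟩
  have hA₀a := hA₀.1.1
  unfold IsAdm at hA₀a
  obtain ⟨a, ha⟩ : A₀.Nonempty := card_pos.1 (by omega)
  set H := -a +ᵥ A₀ with hHdef
  have hH : IsAtom 2 B H := hA₀.vadd (-a)
  have h0H : (0 : G) ∈ H := mem_vadd_finset.2 ⟨a, ha, by rw [vadd_eq_add, neg_add_cancel]⟩
  have hHa := hH.1.1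
  unfold IsAdm at hHa
  have hHfrag := hH.1.2
  -- a subgroup atom settles (iii)
  have case_sub : (∃ K : AddSubgroup G, (K : Set G) = H) →
      (∃ K : AddSubgroup G, ∃ Kf : Finset G, (K : Set G) = Kf ∧ 2 ≤ #Kf ∧
        #(Kf + B) + 2 ≤ Fintype.card G ∧ #(Kf + B) + 1 ≤ #Kf + #B) := by
    rintro ⟨K, hK⟩
    have := card_le_card_add h0 H
    exact ⟨K, H, hK, hHa.1, hHa.2, by omega⟩
  by_cases hκ2 : conn 2 B + 2 ≤ #B
  · exact Or.inr (case_sub (hH.exists_addSubgroup_of_conn_add_two_le h0 h0H hκ2))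
  have hκ1 : conn 2 B + 1 = #B := by omega
  rcases hH.addSubgroup_or_isAP_or_almostPeriodic_or_large h0 hκ1 h0H with
    ⟨-, hK⟩ | hAP | ⟨d, hd, b, hbB, hPne, hPd⟩ | ⟨hbig, -⟩
  · exact Or.inr (case_sub hK)
  · exact Or.inl hAP
  · -- the almost-period `K = ⟨d⟩` of `B = (B ∖ b) ⊔ {b}`
    right
    set P := B.erase b with hP
    set Kf := apFinset (0 : G) d (addOrderOf d) with hKf
    have hbP : b ∉ P := notMem_erase b B
    have hBeq : B = P ∪ apFinset b d 1 := by
      rw [apFinset_one, hP, union_comm, ← insert_eq, insert_erase hbB]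
    obtain ⟨hKB, hdisjK⟩ := apFinset_zero_addOrderOf_add_union_apFinset hPd hbP le_rfl
    rw [← hBeq] at hKB
    have hKBcard : #(Kf + B) = #P + #Kf := by
      rw [hKB, card_union_of_disjoint hdisjK, card_vadd_finset]
    have hKle : #Kf ≤ #P := card_apFinset_zero_addOrderOf_le_card hPd hPne
    have hK2 : 2 ≤ #Kf := two_le_card_apFinset_zero_addOrderOf hd
    have hPcard : #P + 1 = #B := by rw [hP]; exact card_erase_add_one hbB
    obtain ⟨K, hK⟩ := exists_addSubgroup_coe_eq_apFinset_zero_addOrderOf d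
    exact ⟨K, Kf, hK, hK2, by omega, by omega⟩
  · omega

/-- The underlying set of `⟨d⟩ = AddSubgroup.zmultiples d` is `{0, d, …, (o−1) d}`.
[cite: Hamidoune2000, §6 ("let K be the subgroup generated by d")] -/
theorem coe_zmultiples_eq_coe_apFinset (d : G) :
    (AddSubgroup.zmultiples d : Set G) = ↑(apFinset (0 : G) d (addOrderOf d)) := by
  ext y
  rw [SetLike.mem_coe, mem_coe,
    (isOfFinAddOrder_of_finite d).mem_zmultiples_iff_mem_range_addOrderOf, mem_image,
    mem_apFinset]
  simp only [mem_range, zero_add]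

end Isoperimetric

end Literature.Combinatorics.Additive
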